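import Summits.ResolutionOfSingularities.ResolutionOfSingularities.Theorems.PurelyInseparableDim4ResConeLightPairEntry
import Summits.ResolutionOfSingularities.ResolutionOfSingularities.Theorems.PurelyInseparableDim4ResConeTwoSlotDivisibility
import Summits.ResolutionOfSingularities.ResolutionOfSingularities.Theorems.PurelyInseparableDim4TschirnhausHasseContact
import HarnessLib
import HarnessLib.Audit.Tags

/-!
# Purely inseparable four-folds — TWO-SLOT GAME, THE LEDGER IN THE FRAME: the pair-merged Hasse ledger at the
# contact letter, pushed through a Tschirnhaus jet frame, kills the low residual coefficients off the slot
# product (cell `res-dim4-pi`, K2(p) lane, slice B brick K24a, part β3a — the dressing of β3b)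

[OURS · counted 0 · cell `res-dim4-pi` · K2(p) lane (holder res-dim4-p-12 g3, «p-1 takes K24a» 2026-08-29
01:14Z; statement layer 01:24Z, stub β3); seat res-dim4-p-1 g4 over res-dim4-p-2 g4's `pair_hasse_ledger_of_born`
(`…ResConeLightPairEntry`), res-dim4-p-1 g3's D3 `FrameChange.hasseDeriv_single_tsch` (`…TschirnhausHasseContact`)
and β3b `ResCone.coeff_eq_zero_of_pair_ledger` (`…ResConeTwoSlotDivisibility`).]  Nothing here proves K2(p)/K2(5),
`NoIsolatedTrap p p` or resolution of singularities in dimension ≥ 4 / characteristic `p`.  AI kernel work,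
weaker than expert review.

THE DRESSING.  β3b reads `coeff_n G̃ = 0` (`|n| < M`, `n_f < 3`, `n_A = 0 ∨ n_B = 0`) off a pair ledger IN CONTACT
FORM `U·G̃ = S·x_A x_B + T·H̃³`, `H̃ = x_f·W + R`, `R ∈ 𝔪₀^M`.  This file supplies that form along the chain:

* §1 **`pair_hasse_ledger_of_born_at`** — res-dim4-p-2 g4's pair-merged Hasse ledger of two stretch-born boundary
  letters `a ≠ a′`, with the Hasse letter PRESCRIBED: for every third letter `e ∉ {a, a′}` carrying the vertex
  form (`ℓ_k e ≠ 0`), `U·G_k = S·x_a x_{a′} + T·(D_e^{(d−1)} G_k)^d` with `U(0) ≠ 0` (same proof: K11 `stretch_ledger`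
  ×2 → K8 → K2 merge; p-2's theorem chooses SOME `e`, the two-slot game needs `e` = the free letter `f` of the
  T-sector, `ℓ_k f ≠ 0`).
* §2 `ledger_tsch` — the move `x_f ↦ x_f + φ(u)` fixes `x_A`, `x_B` and commutes with `D_f` (D3), so the ledger
  keeps its shape in the frame, with `H̃ = D_f^{(2)} G̃`; `hasseDeriv_eq_X_mul_add_of_jet` — if the frame is
  Tschirnhaus to order `N` (`G̃` has no `x_f^{d−1}·u^m`, `|m| ≤ N`) then `D_f^{(d−1)} G̃ = x_f·W + R`, `R ∈ 𝔪₀^{N+1}`.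
* §3 **`coeff_tsch_eq_zero_of_pair_ledger`** / **`reading_clean_tsch_eq_zero_of_pair_ledger`** — hence in a
  Tschirnhaus frame of order `N`: `coeff_n G̃ = 0` for `|n| ≤ N`, `n_f < 3`, `n_A = 0 ∨ n_B = 0`, and the same read
  on the cleaned framed state `coeff_{r+n} (clean (τ_φ F)) = 0` (β6's `hdivκ` and its mirror).
* §4 **`frame_reading_eq_zero_of_born`** — the chain-level corollary at `d = 3` (`p > 3`): along a power-cone
  stretch, at a stage where the two slot letters are stretch-born and the free letter `f` (`r_k f = 0`) carries
  the vertex form, every Tschirnhaus frame of order `N` at `f` has these vanishing readings.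

[cite: CossartJannsenSaito2020, Thm. 3.10(4), Thm. 3.14] bears_on: LADDER-RESOLUTION:D157-DOOR2 (res-dim4-pi ·
K2(p) · slice B · K24a-β3a).  Supports stmt-ResolutionOfSingularities-16155 (helper).
-/

set_option linter.dupNamespace false -- mandated namespace of this single-conjunct summit

noncomputable section

namespace Summit.ResolutionOfSingularities.ResolutionOfSingularities.Theorems.PIDim4

namespace ResCone

open MvPolynomial Finset FrameChange
open Literature.AlgebraicGeometry.Resolution
open Literature.AlgebraicGeometry.Resolution.CentreBlowup
open Literature.AlgebraicGeometry.Resolution.Hauser2010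
open Literature.AlgebraicGeometry.Resolution.HauserPerlega2019
open PointBlowup (polarMap additiveSubspace direction)

variable {K : Type} [Field K]

/-! ## 1. The pair ledger at a prescribed contact letter -/

section Chain

variable (p : ℕ) [hp : Fact p.Prime] [CharP K p] [DecidableEq K]

/-- **THE PAIR-MERGED HASSE LEDGER AT A PRESCRIBED LETTER** (res-dim4-p-2 g4's `pair_hasse_ledger_of_born` with the
Hasse letter an input): on a power-cone stretch with frame data (`2 ≤ d < p`), two distinct boundary letters
`a, a′` stretch-born and kept since birth, and any third letter `e ∉ {a, a′}` with `ℓ_k e ≠ 0`: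
`U·G_k = S·(x_a x_{a′}) + T·(D_e^{(d−1)} G_k)^d` with `U(0) ≠ 0`. [OURS]
[cite: CossartJannsenSaito2020, Thm. 3.10(4), Thm. 3.14] -/
theorem pair_hasse_ledger_of_born_at {c : ℕ → State K} {j : ℕ → Fin 4} {b : ℕ → Fin 4 → K}
    (hc : ∀ k, IsIsolated p (c k).F ∧ Step0 p (c k) (c (k + 1))) (hw : FreeTail.IsWitnessedChain p c j b)
    (hr0 : ∀ e ∈ (c 0).F.support, (c 0).r ≤ e) (hfloor : ∀ k, ordZero (c k).F ≠ p) {k₀ d : ℕ} (hd2 : 2 ≤ d)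
    (hdp : d < p) (hshade : ∀ k, k₀ ≤ k → (c k).shade = (d : ℕ∞)) {ℓ : ℕ → Fin 4 → K} {a0 lam : ℕ → K}
    (hform : ∀ k, k₀ ≤ k → resForm (c k) = C (a0 k) * (∑ i, C (ℓ k i) * X i) ^ d)
    (hdir : ∀ k, k₀ ≤ k → ℓ k (j k) + dotProduct (ℓ k) (b k) = 0) (hlam : ∀ k, k₀ ≤ k → lam k ≠ 0)
    (hprop : ∀ k, k₀ ≤ k → ∀ i, i ≠ j k → ℓ (k + 1) i = lam k * ℓ k i)
    (hcarry : ∀ k, k₀ ≤ k → ∃ i, i ≠ j k ∧ ℓ k i ≠ 0) {k : ℕ} {a a' e : Fin 4} (haa : a ≠ a')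
    (hea : e ≠ a) (hea' : e ≠ a') (hℓe : ℓ k e ≠ 0)
    {ta ta' : ℕ} (hta : k₀ ≤ ta) (htak : ta < k) (hja : j ta = a)
    (hkepta : ∀ m, ta < m → m < k → j m ≠ a ∧ b m a = 0) (hta' : k₀ ≤ ta') (hta'k : ta' < k)
    (hja' : j ta' = a') (hkepta' : ∀ m, ta' < m → m < k → j m ≠ a' ∧ b m a' = 0) :
    ∃ U S T : MvPolynomial (Fin 4) K, MvPolynomial.eval (0 : Fin 4 → K) U ≠ 0 ∧
      U * ((c k).F.divMonomial (c k).r) =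
        S * (X a * X a') + T * hasseDeriv (Finsupp.single e (d - 1)) ((c k).F.divMonomial (c k).r) ^ d := by
  classical
  have hd1 : 1 ≤ d := by omega
  have hk : k₀ ≤ k := hta.trans htak.le
  -- the residual at `k` and its cone
  obtain ⟨o, ho, hpo, -, hod⟩ := chain_shade_nat p hc hfloor hshade hk
  have hr := IsolatedBand.isolated_chain_forall_le hc hr0 k
  set G := (c k).F.divMonomial (c k).r with hGdef
  have hcone : homogeneousComponent d G = C (a0 k) * (∑ i, C (ℓ k i) * X i) ^ d := by
    have h1 := hform k hk
    rw [resForm_eq_homogeneousComponent_divMonomial ho hr, hod] at h1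
    exact h1
  have ha₀ : a0 k ≠ 0 := ne_zero_of_resForm_eq_C_mul ho hr (hform k hk)
  have hordG : ∀ m ∈ G.support, d ≤ m.degree := by
    rw [hGdef, ← hod]; exact forall_le_degree_divMonomial ho
  -- the two generic ledgers (K11)
  obtain ⟨-, -, ua, ha, hua, hha, hcoefa, hGa⟩ := stretch_ledger p hc hw hr0 hfloor hd1 hshade hform hdir hlam
    hprop hcarry hta htak hja.symm hkepta
  obtain ⟨-, -, ua', ha', hua', hha', hcoefa', hGa'⟩ := stretch_ledger p hc hw hr0 hfloor hd1 hshade hform hdir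
    hlam hprop hcarry hta' hta'k hja'.symm hkepta'
  -- the PRESCRIBED Hasse letter `e` (K8)
  have hwit : coeff (Finsupp.single e d) G ≠ 0 := by
    rw [show coeff (Finsupp.single e d) G = coeff (Finsupp.single e d) (homogeneousComponent d G) by
      rw [coeff_homogeneousComponent, Finsupp.degree_single, if_pos rfl], hcone, coeff_C_mul,
      coeff_single_pow_linearForm]
    exact mul_ne_zero ha₀ (pow_ne_zero _ hℓe)
  set H := hasseDeriv (Finsupp.single e (d - 1)) G with hHdef
  obtain ⟨va, hva, hHa⟩ := IsolatedBand.exists_unit_mul_mem_span_X_hasseDeriv_pow_of_mem p hea hd1 hdp hha hGa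
    hua (by rw [IsolatedBand.eval_hasseDeriv_single_one]; exact hcoefa e hea hℓe) hordG
    (Finsupp.single_eq_of_ne hea.symm) (Finsupp.degree_single e d) hwit
  obtain ⟨va', hva', hHa'⟩ := IsolatedBand.exists_unit_mul_mem_span_X_hasseDeriv_pow_of_mem p hea' hd1 hdp hha'
    hGa' hua' (by rw [IsolatedBand.eval_hasseDeriv_single_one]; exact hcoefa' e hea' hℓe) hordG
    (Finsupp.single_eq_of_ne hea'.symm) (Finsupp.degree_single e d) hwit
  -- the merge (K2)
  have hHaa : H ∉ Ideal.span {(X a : MvPolynomial (Fin 4) K), X a'} :=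
    IsolatedBand.hasseDeriv_powerCone_not_mem_span_X_pair p hea hea' hd1 hdp ha₀ hℓe hcone
  set U := va * va' with hUdef
  have hUa : U * G ∈ Ideal.span {(X a : MvPolynomial (Fin 4) K), H ^ d} := by
    rw [show U * G = va' * (va * G) by rw [hUdef]; ring]; exact Ideal.mul_mem_left _ _ hHa
  have hUa' : U * G ∈ Ideal.span {(X a' : MvPolynomial (Fin 4) K), H ^ d} := by
    rw [show U * G = va * (va' * G) by rw [hUdef]; ring]; exact Ideal.mul_mem_left _ _ hHa'
  obtain ⟨S, T, hST⟩ := Ideal.mem_span_pair.mp (IsolatedBand.mem_span_mul_of_mem_span_of_mem_span haa hHaa hUa hUa')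
  have hU : MvPolynomial.eval (0 : Fin 4 → K) U ≠ 0 := by rw [hUdef, map_mul]; exact mul_ne_zero hva hva'
  exact ⟨U, S, T, hU, hST.symm⟩

end Chain

/-! ## 2. The ledger in a frame, and the jet shape of the framed contact polynomial -/

/-- **The Tschirnhaus move keeps the pair ledger at the contact letter**: `τ_φ` (`x_f ↦ x_f + φ(u)`) fixes the
slot letters `x_A, x_B` (`A, B ≠ f`) and commutes with `D_f^{(n)}` (D3 `hasseDeriv_single_tsch`), so
`U·G = S·x_A x_B + T·(D_f^{(n)} G)^d` becomes `Ũ·G̃ = S̃·x_A x_B + T̃·(D_f^{(n)} G̃)^d`. [folklore]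
[cite: CossartPiltant2009, I.8.3.6] -/
theorem ledger_tsch {f A B : Fin 4} (hAf : A ≠ f) (hBf : B ≠ f) {φ : MvPolynomial (Fin 4) K}
    (hφ : f ∉ φ.vars) {G U S T : MvPolynomial (Fin 4) K} {n d : ℕ}
    (hledger : U * G = S * (X A * X B) + T * hasseDeriv (Finsupp.single f n) G ^ d) :
    tsch f φ U * tsch f φ G =
      tsch f φ S * (X A * X B) + tsch f φ T * hasseDeriv (Finsupp.single f n) (tsch f φ G) ^ d := by
  have h := congrArg (tsch f φ) hledger
  rw [map_mul, map_add, map_mul, map_mul, map_mul, map_pow, tsch_X_of_ne φ hAf, tsch_X_of_ne φ hBf,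
    ← hasseDeriv_single_tsch hφ] at h
  exact h

/-- **Jet shape of the contact polynomial in a Tschirnhaus frame**: if `P` has no monomial `x_f^{d−1}·u^m` with
`|m| ≤ N`, then `D_f^{(d−1)} P = x_f·W + R` with `R ∈ 𝔪₀^{N+1}` (`R` = the `x_f`-free part of the derivative; its
`u^m`-coefficient is `coeff_{x_f^{d−1} u^m} P`). [cite: Abhyankar1990, Lecture 22 p.186] [folklore] -/
theorem hasseDeriv_eq_X_mul_add_of_jet (f : Fin 4) {d N : ℕ} {P : MvPolynomial (Fin 4) K}
    (hN : ∀ n : Fin 4 →₀ ℕ, n f = d - 1 → n.degree ≤ N + (d - 1) → coeff n P = 0) :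
    ∃ W R : MvPolynomial (Fin 4) K, hasseDeriv (Finsupp.single f (d - 1)) P = X f * W + R ∧
      R ∈ originIdeal K ^ (N + 1) := by
  classical
  set H := hasseDeriv (Finsupp.single f (d - 1)) P with hH
  refine ⟨H.divMonomial (Finsupp.single f 1), H.modMonomial (Finsupp.single f 1),
    (H.divMonomial_add_modMonomial_single f).symm, ?_⟩
  rw [IsolationCert.mem_originIdeal_pow_iff]
  intro m hm
  by_cases hmf : m f = 0
  · have hnot : ¬ Finsupp.single f 1 ≤ m := fun h => by
      have h1 := h f
      rw [Finsupp.single_eq_same, hmf] at h1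
      exact absurd h1 (by norm_num)
    rw [coeff_modMonomial_of_not_le _ hnot, hH, IsolatedBand.coeff_hasseDeriv_single', hN _ ?_ ?_, mul_zero]
    · rw [Finsupp.add_apply, Finsupp.single_eq_same, hmf, zero_add]
    · rw [map_add, Finsupp.degree_single]; omega
  · have hle : Finsupp.single f 1 ≤ m := Finsupp.single_le_iff.mpr (by omega)
    rw [coeff_modMonomial_of_le _ hle]

/-! ## 3. The read-off in a Tschirnhaus frame -/

/-- **DIVISIBILITY READINGS IN THE FRAME** (β3 = β3a ∘ β3b): a pair ledger `U·G = S·x_A x_B + T·(D_f^{(2)} G)³` with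
`U(0) ≠ 0` and a frame `x_f ↦ x_f + φ(u)` that is Tschirnhaus to order `N` for `G` (`G̃ = τ_φ G` has no
`x_f²·u^m`, `|m| ≤ N`) give `coeff_n G̃ = 0` for `|n| ≤ N`, `n_f < 3`, `n_A = 0 ∨ n_B = 0`: in the jet frame the residual
lies in `(x_A x_B, x_f³) + 𝔪₀^{N+1}`. [OURS] [cite: CossartJannsenSaito2020, Thm. 3.14] -/
theorem coeff_tsch_eq_zero_of_pair_ledger {f A B : Fin 4} (hAf : A ≠ f) (hBf : B ≠ f)
    {φ : MvPolynomial (Fin 4) K} (hφ : f ∉ φ.vars) (h0 : constantCoeff φ = 0)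
    {G U S T : MvPolynomial (Fin 4) K} (hU : constantCoeff U ≠ 0)
    (hledger : U * G = S * (X A * X B) + T * hasseDeriv (Finsupp.single f 2) G ^ 3) {N : ℕ}
    (hN : ∀ n : Fin 4 →₀ ℕ, n f = 2 → n.degree ≤ N + 2 → coeff n (tsch f φ G) = 0)
    {n : Fin 4 →₀ ℕ} (hnN : n.degree ≤ N) (hnf : n f < 3) (hn : n A = 0 ∨ n B = 0) :
    coeff n (tsch f φ G) = 0 := by
  have hL := ledger_tsch hAf hBf hφ hledger
  obtain ⟨W, R, hWR, hR⟩ := hasseDeriv_eq_X_mul_add_of_jet f (d := 3) (N := N) (P := tsch f φ G) hN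
  have hU' : constantCoeff (tsch f φ U) ≠ 0 := by rw [constantCoeff_tsch h0]; exact hU
  exact coeff_eq_zero_of_pair_ledger hU' hL hWR hR (by omega) hnf hn

/-- **The same, read on the cleaned framed state** `clean (τ_φ F)`, `F = x^r·G`, `r_f = 0`: `coeff_{r+m} = 0` for
`|m| ≤ N`, `m_f < 3`, `m_A = 0 ∨ m_B = 0` (cleaning only deletes monomials). [OURS]
[cite: CossartJannsenSaito2020, Thm. 3.14] -/
theorem reading_clean_tsch_eq_zero_of_pair_ledger (q : ℕ) {f A B : Fin 4} (hAf : A ≠ f) (hBf : B ≠ f)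
    {φ : MvPolynomial (Fin 4) K} (hφ : f ∉ φ.vars) (h0 : constantCoeff φ = 0)
    {F G U S T : MvPolynomial (Fin 4) K} {r : Fin 4 →₀ ℕ} (hrf : r f = 0) (hF : F = monomial r 1 * G)
    (hU : constantCoeff U ≠ 0)
    (hledger : U * G = S * (X A * X B) + T * hasseDeriv (Finsupp.single f 2) G ^ 3) {N : ℕ}
    (hN : ∀ n : Fin 4 →₀ ℕ, n f = 2 → n.degree ≤ N + 2 → coeff n (tsch f φ G) = 0)
    {m : Fin 4 →₀ ℕ} (hmN : m.degree ≤ N) (hmf : m f < 3) (hm : m A = 0 ∨ m B = 0) :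
    coeff (r + m) (deletePthPowers q (tsch f φ F)) = 0 := by
  classical
  rw [coeff_deletePthPowers]
  split_ifs
  · rfl
  rw [hF, tsch_monomial_mul φ hrf, coeff_monomial_mul', if_pos le_self_add, add_tsub_cancel_left, one_mul]
  exact coeff_tsch_eq_zero_of_pair_ledger hAf hBf hφ h0 hU hledger hN hmN hmf hm

/-! ## 4. Along the chain: readings of the two-slot regime in a jet frame -/

section ChainReadings

variable (p : ℕ) [hp : Fact p.Prime] [CharP K p] [DecidableEq K]

/-- **LEDGER READINGS OF THE TWO-SLOT REGIME** (K24a-β3, chain level, `d = 3`, `p > 3`): on a power-cone stretch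
with frame data, at a stage `k` where two distinct boundary letters `A, B` are stretch-born and kept, a letter
`f ∉ {A, B}` with `r_k f = 0` carries the vertex form (`ℓ_k f ≠ 0`, the T-sector), and `φ` is a frame at `f`
Tschirnhaus to order `N` for the residual `G_k`: `coeff_{r_k + m} (clean (τ_φ F_k)) = 0` for `|m| ≤ N`, `m_f < 3`,
`m_A = 0 ∨ m_B = 0`. [OURS] [cite: CossartJannsenSaito2020, Thm. 3.10(4), Thm. 3.14] -/
theorem frame_reading_eq_zero_of_born {c : ℕ → State K} {j : ℕ → Fin 4} {b : ℕ → Fin 4 → K}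
    (hc : ∀ k, IsIsolated p (c k).F ∧ Step0 p (c k) (c (k + 1))) (hw : FreeTail.IsWitnessedChain p c j b)
    (hr0 : ∀ e ∈ (c 0).F.support, (c 0).r ≤ e) (hfloor : ∀ k, ordZero (c k).F ≠ p) {k₀ : ℕ} (h3p : 3 < p)
    (hshade : ∀ k, k₀ ≤ k → (c k).shade = ((3 : ℕ) : ℕ∞)) {ℓ : ℕ → Fin 4 → K} {a0 lam : ℕ → K}
    (hform : ∀ k, k₀ ≤ k → resForm (c k) = C (a0 k) * (∑ i, C (ℓ k i) * X i) ^ 3)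
    (hdir : ∀ k, k₀ ≤ k → ℓ k (j k) + dotProduct (ℓ k) (b k) = 0) (hlam : ∀ k, k₀ ≤ k → lam k ≠ 0)
    (hprop : ∀ k, k₀ ≤ k → ∀ i, i ≠ j k → ℓ (k + 1) i = lam k * ℓ k i)
    (hcarry : ∀ k, k₀ ≤ k → ∃ i, i ≠ j k ∧ ℓ k i ≠ 0) {k : ℕ} {A B f : Fin 4} (hAB : A ≠ B)
    (hAf : A ≠ f) (hBf : B ≠ f) (hℓf : ℓ k f ≠ 0) (hrf : (c k).r f = 0)
    {tA tB : ℕ} (htA : k₀ ≤ tA) (htAk : tA < k) (hjA : j tA = A)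
    (hkeptA : ∀ m, tA < m → m < k → j m ≠ A ∧ b m A = 0) (htB : k₀ ≤ tB) (htBk : tB < k)
    (hjB : j tB = B) (hkeptB : ∀ m, tB < m → m < k → j m ≠ B ∧ b m B = 0)
    {φ : MvPolynomial (Fin 4) K} (hφ : f ∉ φ.vars) (h0 : constantCoeff φ = 0) {N : ℕ}
    (hN : ∀ n : Fin 4 →₀ ℕ, n f = 2 → n.degree ≤ N + 2 →
      coeff n (tsch f φ ((c k).F.divMonomial (c k).r)) = 0)
    {m : Fin 4 →₀ ℕ} (hmN : m.degree ≤ N) (hmf : m f < 3) (hm : m A = 0 ∨ m B = 0) :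
    coeff ((c k).r + m) (deletePthPowers p (tsch f φ (c k).F)) = 0 := by
  obtain ⟨U, S, T, hU, hledger⟩ := pair_hasse_ledger_of_born_at p hc hw hr0 hfloor (by norm_num) h3p hshade
    hform hdir hlam hprop hcarry hAB hAf.symm hBf.symm hℓf htA htAk hjA hkeptA htB htBk hjB hkeptB
  have hr := IsolatedBand.isolated_chain_forall_le hc hr0 k
  have hU' : constantCoeff U ≠ 0 := by rwa [← MvPolynomial.eval_zero]
  exact reading_clean_tsch_eq_zero_of_pair_ledger p hAf hBf hφ h0 hrf (monomial_mul_divMonomial hr).symm hU'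
    hledger hN hmN hmf hm

end ChainReadings

end ResCone

end Summit.ResolutionOfSingularities.ResolutionOfSingularities.Theorems.PIDim4

end
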